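import Summits.AtomisticToContinuum.Crystallization.Theorems.ExcessDecayLiouvilleParamArithH

/-!
# Route `ExcessDecayLiouville`: the numerical conditions of the final parameter choice, IV (pure arithmetic, I)

Harmonic-replacement architecture for item `ExcessDecay` (stmt-AtomisticToContinuum-9334), nonlinear half.
In the regime `L¹⁰⁰⁰ ≤ δ¹⁰ r`, `L¹⁰⁰⁰ ε ≤ δ`, `C_f/r² < ε/2` (`C_f = L⁴⁰⁰/δ¹⁰`): the final height is
`≤ ε/2 + C_f/r²`, the final slope is `≤ C_f ε/r`, and the geometric side conditions of `near_of_envelope` hold with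
`θ = 1/(64L⁹⁰)`.
All `[folklore]`; pure real inequalities, nothing here closes an item.
-/

namespace Summit.AtomisticToContinuum.Crystallization.Theorems.ExcessDecayLiouville

/-- **The final height**: `L⁸V⋆ + (3L¹³ + 28L⁸)U_max + L⁶((1 + Λ L¹⁰²)U_max + L¹¹⁹𝚽 + L⁶⁸Du/r²) ≤ ε/2 + C_f/r²`.
[folklore] -/
theorem final_height {L δ r ε Vstar Umax Φ Du Λs : ℝ} (hL : 239000000 ≤ L) (hδ : 0 < δ) (hδ1 : δ ≤ 1)
    (hr' : L ^ 1000 ≤ δ ^ 10 * r) (hε0 : 0 ≤ ε)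
    (hV : Vstar ≤ ε / L ^ 58 + L ^ 167 / (δ ^ 3 * r ^ 2)) (hU0 : 0 ≤ Umax)
    (hUm : Umax ≤ L ^ 13 * ε / r + L ^ 238 / (δ ^ 3 * r ^ 3))
    (hΦ : Φ ≤ 4 * L / (δ ^ 3 * r ^ 4)) (hDu : Du = L ^ 30 * ε + L ^ 250 / (δ ^ 3 * r ^ 2))
    (hΛ : Λs ≤ 1 / L ^ 57) :
    L ^ 8 * Vstar + (3 * L ^ 13 + 28 * L ^ 8) * Umax + L ^ 6 * ((1 + Λs * L ^ 102) * Umax + L ^ 119 * Φ + L ^ 68 * Du / r ^ 2) ≤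
      ε / 2 + (L ^ 400 / δ ^ 10) / r ^ 2 := by
  have hL1 : (1 : ℝ) ≤ L := by linarith
  have hL0 : (0 : ℝ) < L := by linarith
  have hr0 : 0 < r := r_pos_of_regime hL1 hδ hr'
  have hr : L ^ 1000 ≤ r := r_ge_of_regime hL1 hδ hδ1 hr'
  have hr1 : 1 ≤ r := le_trans (one_le_pow₀ hL1) hr
  have pw : ∀ {a b : ℕ}, a ≤ b → L ^ a ≤ L ^ b := fun h => pow_le_pow_right₀ hL1 h
  obtain ⟨T, hT⟩ : ∃ T : ℝ, T = (L ^ 400 / δ ^ 10) / r ^ 2 := ⟨_, rfl⟩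
  rw [← hT]
  have hδ10 : δ ^ 10 ≤ δ ^ 3 := pow_le_pow_of_le_one hδ.le hδ1 (by norm_num)
  have hδp : 0 < δ ^ 10 := by positivity
  -- a floor `L^a/(δ³ r^k)` (k ≥ 2) is below `T · L^a δ⁷ … ≤ T/8` when `8 L^a ≤ L^400`
  have floor_le : ∀ {a k : ℕ}, 2 ≤ k → 8 * L ^ a ≤ L ^ 400 → L ^ a / (δ ^ 3 * r ^ k) ≤ T / 8 := by
    intro a k hk ha
    have hrk : r ^ 2 ≤ r ^ k := pow_le_pow_right₀ hr1 hk
    have h1 : L ^ a / (δ ^ 3 * r ^ k) ≤ L ^ a / (δ ^ 3 * r ^ 2) :=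
      div_le_div_of_nonneg_left (by positivity) (by positivity) (mul_le_mul_of_nonneg_left hrk (by positivity))
    have h2 : L ^ a / (δ ^ 3 * r ^ 2) ≤ (L ^ 400 / 8) / (δ ^ 10 * r ^ 2) := by
      rw [div_le_div_iff₀ (by positivity) (by positivity)]
      calc L ^ a * (δ ^ 10 * r ^ 2) = (8 * L ^ a) * δ ^ 10 * r ^ 2 / 8 := by ring
        _ ≤ L ^ 400 * δ ^ 3 * r ^ 2 / 8 := by
            refine div_le_div_of_nonneg_right ?_ (by norm_num)
            refine mul_le_mul_of_nonneg_right (mul_le_mul ha hδ10 (by positivity) (by positivity)) (by positivity)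
        _ = L ^ 400 / 8 * (δ ^ 3 * r ^ 2) := by ring
    have e : (L ^ 400 / 8) / (δ ^ 10 * r ^ 2) = T / 8 := by rw [hT]; field_simp
    rw [← e]; exact h1.trans h2
  -- an `ε`-term `L^a ε / r^k` (k ≥ 1) is below `ε/16` when `16 L^a ≤ L^1000`
  have eps_le : ∀ {a k : ℕ}, 1 ≤ k → 16 * L ^ a ≤ L ^ 1000 → L ^ a * ε / r ^ k ≤ ε / 16 := by
    intro a k hk ha
    rw [div_le_div_iff₀ (by positivity) (by norm_num)]
    have hrk : r ≤ r ^ k := by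
      calc r = r ^ 1 := (pow_one r).symm
        _ ≤ r ^ k := pow_le_pow_right₀ hr1 hk
    have : 16 * L ^ a ≤ r ^ k := ha.trans (hr.trans hrk)
    nlinarith
  -- (1) L⁸ V⋆
  have t1 : L ^ 8 * Vstar ≤ ε / 4 + T / 8 := by
    have h := mul_le_mul_of_nonneg_left hV (by positivity : (0 : ℝ) ≤ L ^ 8)
    have e : L ^ 8 * (ε / L ^ 58 + L ^ 167 / (δ ^ 3 * r ^ 2)) = (L ^ 8 / L ^ 58) * ε + L ^ 175 / (δ ^ 3 * r ^ 2) := by ring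
    have k1 : L ^ 8 / L ^ 58 ≤ 1 / 4 := by
      rw [div_le_div_iff₀ (by positivity) (by norm_num)]
      calc L ^ 8 * 4 ≤ L ^ 8 * L := mul_le_mul_of_nonneg_left (by linarith) (by positivity)
        _ = L ^ 9 := by ring
        _ ≤ L ^ 58 := pw (by norm_num)
        _ = 1 * L ^ 58 := (one_mul _).symm
    have k2 : L ^ 175 / (δ ^ 3 * r ^ 2) ≤ T / 8 := floor_le le_rfl (by
      calc 8 * L ^ 175 ≤ L * L ^ 175 := mul_le_mul_of_nonneg_right (by linarith) (by positivity)
        _ = L ^ 176 := by ring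
        _ ≤ L ^ 400 := pw (by norm_num))
    have s1 := mul_le_mul_of_nonneg_right k1 hε0
    linarith
  -- (2) the slope/jump pollution
  have t2 : (3 * L ^ 13 + 28 * L ^ 8) * Umax ≤ ε / 16 + T / 8 := by
    have hc : 3 * L ^ 13 + 28 * L ^ 8 ≤ L ^ 15 := by
      have h8 : L ^ 8 ≤ L ^ 13 := pw (by norm_num)
      calc 3 * L ^ 13 + 28 * L ^ 8 ≤ 31 * L ^ 13 := by linarith
        _ ≤ L ^ 2 * L ^ 13 := mul_le_mul_of_nonneg_right (le_trans (by norm_num) (pow_le_pow_left₀ (by norm_num) hL 2)) (by positivity)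
        _ = L ^ 15 := by ring
    have h1 : (3 * L ^ 13 + 28 * L ^ 8) * Umax ≤ L ^ 15 * (L ^ 13 * ε / r + L ^ 238 / (δ ^ 3 * r ^ 3)) :=
      mul_le_mul hc hUm hU0 (by positivity)
    have e : L ^ 15 * (L ^ 13 * ε / r + L ^ 238 / (δ ^ 3 * r ^ 3)) = L ^ 28 * ε / r ^ 1 + L ^ 253 / (δ ^ 3 * r ^ 3) := by ring
    rw [e] at h1
    have k1 : L ^ 28 * ε / r ^ 1 ≤ ε / 16 := eps_le le_rfl (by
      calc 16 * L ^ 28 ≤ L * L ^ 28 := mul_le_mul_of_nonneg_right (by linarith) (by positivity)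
        _ = L ^ 29 := by ring
        _ ≤ L ^ 1000 := pw (by norm_num))
    have k2 : L ^ 253 / (δ ^ 3 * r ^ 3) ≤ T / 8 := floor_le (by norm_num) (by
      calc 8 * L ^ 253 ≤ L * L ^ 253 := mul_le_mul_of_nonneg_right (by linarith) (by positivity)
        _ = L ^ 254 := by ring
        _ ≤ L ^ 400 := pw (by norm_num))
    linarith
  -- (3) the last-scale terms
  have t3 : L ^ 6 * ((1 + Λs * L ^ 102) * Umax) ≤ ε / 16 + T / 8 := by
    have hΛ' : 1 + Λs * L ^ 102 ≤ 2 * L ^ 45 := by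
      have h1 : Λs * L ^ 102 ≤ (1 / L ^ 57) * L ^ 102 := mul_le_mul_of_nonneg_right hΛ (by positivity)
      have e : (1 / L ^ 57) * L ^ 102 = L ^ 45 := by
        rw [div_mul_eq_mul_div, one_mul, div_eq_iff (by positivity)]; ring
      have h2 : (1 : ℝ) ≤ L ^ 45 := one_le_pow₀ hL1
      linarith
    have h1 : L ^ 6 * ((1 + Λs * L ^ 102) * Umax) ≤ L ^ 6 * ((2 * L ^ 45) * (L ^ 13 * ε / r + L ^ 238 / (δ ^ 3 * r ^ 3))) := by
      refine mul_le_mul_of_nonneg_left (mul_le_mul hΛ' hUm hU0 (by positivity)) (by positivity)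
    have e : L ^ 6 * ((2 * L ^ 45) * (L ^ 13 * ε / r + L ^ 238 / (δ ^ 3 * r ^ 3))) =
        2 * (L ^ 64 * ε / r ^ 1) + 2 * (L ^ 289 / (δ ^ 3 * r ^ 3)) := by ring
    rw [e] at h1
    have k1 : L ^ 64 * ε / r ^ 1 ≤ ε / 16 := eps_le le_rfl (by
      calc 16 * L ^ 64 ≤ L * L ^ 64 := mul_le_mul_of_nonneg_right (by linarith) (by positivity)
        _ = L ^ 65 := by ring
        _ ≤ L ^ 1000 := pw (by norm_num))
    have k2 : L ^ 289 / (δ ^ 3 * r ^ 3) ≤ T / 8 := floor_le (by norm_num) (by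
      calc 8 * L ^ 289 ≤ L * L ^ 289 := mul_le_mul_of_nonneg_right (by linarith) (by positivity)
        _ = L ^ 290 := by ring
        _ ≤ L ^ 400 := pw (by norm_num))
    have k1' : L ^ 64 * ε / r ^ 1 ≤ ε / 32 + ε / 32 := by linarith
    -- sharpen: we only have ε/16 for this pair, so halve via r ≥ 32·16 L⁶⁴
    have k3 : 2 * (L ^ 64 * ε / r ^ 1) ≤ ε / 16 := by
      rw [pow_one]
      rw [show 2 * (L ^ 64 * ε / r) = (2 * L ^ 64) * ε / r by ring, div_le_div_iff₀ hr0 (by norm_num)]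
      have : 32 * L ^ 64 ≤ r := by
        calc 32 * L ^ 64 ≤ L * L ^ 64 := mul_le_mul_of_nonneg_right (by linarith) (by positivity)
          _ = L ^ 65 := by ring
          _ ≤ L ^ 1000 := pw (by norm_num)
          _ ≤ r := hr
      nlinarith
    have k4 : 2 * (L ^ 289 / (δ ^ 3 * r ^ 3)) ≤ T / 8 := by
      have k5 : L ^ 290 / (δ ^ 3 * r ^ 3) ≤ T / 8 := floor_le (by norm_num) (by
        calc 8 * L ^ 290 ≤ L * L ^ 290 := mul_le_mul_of_nonneg_right (by linarith) (by positivity)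
          _ = L ^ 291 := by ring
          _ ≤ L ^ 400 := pw (by norm_num))
      have : 2 * L ^ 289 ≤ L ^ 290 := by
        calc 2 * L ^ 289 ≤ L * L ^ 289 := mul_le_mul_of_nonneg_right (by linarith) (by positivity)
          _ = L ^ 290 := by ring
      have h6 : 2 * (L ^ 289 / (δ ^ 3 * r ^ 3)) ≤ L ^ 290 / (δ ^ 3 * r ^ 3) := by
        rw [← mul_div_assoc]; exact div_le_div_of_nonneg_right this (by positivity)
      linarith
    linarith
  have t4 : L ^ 6 * (L ^ 119 * Φ) ≤ T / 8 := by
    have h1 : L ^ 6 * (L ^ 119 * Φ) ≤ L ^ 125 * (4 * L / (δ ^ 3 * r ^ 4)) := by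
      calc L ^ 6 * (L ^ 119 * Φ) = L ^ 125 * Φ := by ring
        _ ≤ L ^ 125 * (4 * L / (δ ^ 3 * r ^ 4)) := mul_le_mul_of_nonneg_left hΦ (by positivity)
    have e : L ^ 125 * (4 * L / (δ ^ 3 * r ^ 4)) = 4 * (L ^ 126 / (δ ^ 3 * r ^ 4)) := by ring
    rw [e] at h1
    have k : L ^ 127 / (δ ^ 3 * r ^ 4) ≤ T / 8 := floor_le (by norm_num) (by
      calc 8 * L ^ 127 ≤ L * L ^ 127 := mul_le_mul_of_nonneg_right (by linarith) (by positivity)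
        _ = L ^ 128 := by ring
        _ ≤ L ^ 400 := pw (by norm_num))
    have : 4 * L ^ 126 ≤ L ^ 127 := by
      calc 4 * L ^ 126 ≤ L * L ^ 126 := mul_le_mul_of_nonneg_right (by linarith) (by positivity)
        _ = L ^ 127 := by ring
    have h6 : 4 * (L ^ 126 / (δ ^ 3 * r ^ 4)) ≤ L ^ 127 / (δ ^ 3 * r ^ 4) := by
      rw [← mul_div_assoc]; exact div_le_div_of_nonneg_right this (by positivity)
    linarith
  have t5 : L ^ 6 * (L ^ 68 * Du / r ^ 2) ≤ ε / 16 + T / 8 := by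
    rw [hDu]
    have e : L ^ 6 * (L ^ 68 * (L ^ 30 * ε + L ^ 250 / (δ ^ 3 * r ^ 2)) / r ^ 2) = L ^ 104 * ε / r ^ 2 + L ^ 324 / (δ ^ 3 * r ^ 4) := by
      field_simp
    rw [e]
    have k1 : L ^ 104 * ε / r ^ 2 ≤ ε / 16 := eps_le (by norm_num) (by
      calc 16 * L ^ 104 ≤ L * L ^ 104 := mul_le_mul_of_nonneg_right (by linarith) (by positivity)
        _ = L ^ 105 := by ring
        _ ≤ L ^ 1000 := pw (by norm_num))
    have k2 : L ^ 324 / (δ ^ 3 * r ^ 4) ≤ T / 8 := floor_le (by norm_num) (by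
      calc 8 * L ^ 324 ≤ L * L ^ 324 := mul_le_mul_of_nonneg_right (by linarith) (by positivity)
        _ = L ^ 325 := by ring
        _ ≤ L ^ 400 := pw (by norm_num))
    linarith
  have hT0 : 0 ≤ T := by rw [hT]; positivity
  have e : L ^ 6 * ((1 + Λs * L ^ 102) * Umax + L ^ 119 * Φ + L ^ 68 * Du / r ^ 2) =
      L ^ 6 * ((1 + Λs * L ^ 102) * Umax) + L ^ 6 * (L ^ 119 * Φ) + L ^ 6 * (L ^ 68 * Du / r ^ 2) := by ring
  rw [e]
  linarith

/-- **The final slope and the geometric side conditions.** [folklore] -/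
theorem final_side {L δ r ε ξn Va s bT ρ₀ : ℝ} (hL : 239000000 ≤ L) (hδ : 0 < δ) (hδ1 : δ ≤ 1)
    (hr' : L ^ 1000 ≤ δ ^ 10 * r) (hε0 : 0 ≤ ε) (hε' : L ^ 1000 * ε ≤ δ)
    (hreg : (L ^ 400 / δ ^ 10) / r ^ 2 < ε / 2)
    (hξn : ξn ≤ L ^ 2 * ε + L ^ 2 / (δ ^ 3 * r ^ 4))
    (hVas : Va + s ≤ L ^ 12 * ε + L ^ 10 / (δ ^ 3 * r ^ 2))
    (hbT : bT ≤ L ^ 13 * ε / r + L ^ 11 / (δ ^ 3 * r ^ 3))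
    (hρ₀lo : r / (16 * L ^ 90) ≤ ρ₀) (hρ₀hi : ρ₀ ≤ r / L ^ 70) :
    bT ≤ (L ^ 400 / δ ^ 10) * ε / r ∧ ξn + Va + bT * (11 / 10) + s ≤ 1 ∧ bT ≤ 1 / 2 ∧
    2 * ((1 / (64 * L ^ 90)) * r + (ξn + Va + bT * (11 / 10) + s)) + ε ≤ ρ₀ ∧
    2 * ((1 / (64 * L ^ 90)) * r + (ξn + Va + bT * (11 / 10) + s)) + 2 * ε ≤ r ∧
    64 ≤ ρ₀ ∧ 737600 * ρ₀ + 153600 ≤ r ∧ ρ₀ ≤ r / 4 ∧ ρ₀ ≤ r / 8 := by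
  have hL1 : (1 : ℝ) ≤ L := by linarith
  have hL0 : (0 : ℝ) < L := by linarith
  have hr0 : 0 < r := r_pos_of_regime hL1 hδ hr'
  have hr : L ^ 1000 ≤ r := r_ge_of_regime hL1 hδ hδ1 hr'
  have hr1 : 1 ≤ r := le_trans (one_le_pow₀ hL1) hr
  have hδ3 : 0 < δ ^ 3 := by positivity
  have pw : ∀ {a b : ℕ}, a ≤ b → L ^ a ≤ L ^ b := fun h => pow_le_pow_right₀ hL1 h
  obtain ⟨hε20, -, -, -, -, hr192⟩ := basic_conds hL hδ hδ1 hr' hε0 hε'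
  -- the slope
  have hslope : bT ≤ (L ^ 400 / δ ^ 10) * ε / r := by
    refine hbT.trans ?_
    have hδ10 : δ ^ 10 ≤ 1 := pow_le_one₀ hδ.le hδ1
    have hCf : L ^ 400 ≤ L ^ 400 / δ ^ 10 := by
      rw [le_div_iff₀ (by positivity)]; exact mul_le_of_le_one_right (by positivity) hδ10
    -- ε-part
    have h1 : L ^ 13 * ε / r ≤ ((L ^ 400 / δ ^ 10) * ε / r) / 2 := by
      rw [div_div, div_le_div_iff₀ hr0 (by positivity)]
      have : 2 * L ^ 13 ≤ L ^ 400 / δ ^ 10 := by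
        refine le_trans ?_ hCf
        calc 2 * L ^ 13 ≤ L * L ^ 13 := mul_le_mul_of_nonneg_right (by linarith) (by positivity)
          _ = L ^ 14 := by ring
          _ ≤ L ^ 400 := pw (by norm_num)
      have h0 : 0 ≤ ε * r := by positivity
      nlinarith
    -- floor part, through the regime: C_f ε/2 > C_f²/r² ≥ L¹¹/(δ³ r²)
    have h2 : L ^ 11 / (δ ^ 3 * r ^ 3) ≤ ((L ^ 400 / δ ^ 10) * ε / r) / 2 := by
      have hreg' : (L ^ 400 / δ ^ 10) / r ^ 2 * (L ^ 400 / δ ^ 10) ≤ ε / 2 * (L ^ 400 / δ ^ 10) :=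
        mul_le_mul_of_nonneg_right hreg.le (by positivity)
      have h3 : L ^ 11 / (δ ^ 3 * r ^ 2) ≤ (L ^ 400 / δ ^ 10) / r ^ 2 * (L ^ 400 / δ ^ 10) := by
        rw [div_mul_eq_mul_div, div_mul_div_comm, div_div, div_le_div_iff₀ (by positivity) (by positivity)]
        have hδ20 : δ ^ 10 * δ ^ 10 ≤ δ ^ 3 := by
          rw [← pow_add]; exact pow_le_pow_of_le_one hδ.le hδ1 (by norm_num)
        calc L ^ 11 * (δ ^ 10 * δ ^ 10 * r ^ 2) ≤ L ^ 11 * (δ ^ 3 * r ^ 2) := by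
              refine mul_le_mul_of_nonneg_left (mul_le_mul_of_nonneg_right hδ20 (by positivity)) (by positivity)
          _ ≤ (L ^ 400 * L ^ 400) * (δ ^ 3 * r ^ 2) := by
              refine mul_le_mul_of_nonneg_right ?_ (by positivity)
              calc L ^ 11 ≤ L ^ 800 := pw (by norm_num)
                _ = L ^ 400 * L ^ 400 := by ring
      have e : ε / 2 * (L ^ 400 / δ ^ 10) = ((L ^ 400 / δ ^ 10) * ε / r) / 2 * r := by
        field_simp
      have h4 : L ^ 11 / (δ ^ 3 * r ^ 3) = (L ^ 11 / (δ ^ 3 * r ^ 2)) / r := by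
        field_simp
      rw [h4, div_le_iff₀ hr0]
      calc L ^ 11 / (δ ^ 3 * r ^ 2) ≤ ε / 2 * (L ^ 400 / δ ^ 10) := h3.trans hreg'
        _ = ((L ^ 400 / δ ^ 10) * ε / r) / 2 * r := e
    linarith
  -- the data bound Ma ≤ 1 (in fact tiny)
  have k1 : 8 * L ^ 2 * ε ≤ 1 := killD2 (m := 1) hL1 hδ1 hε0 hε' (const_le_pow hL (by norm_num)) (by norm_num)
  have k2 : 8 * L ^ 2 / (δ ^ 3 * r ^ 4) ≤ 1 := killB2 (m := 1) hL1 hδ hδ1 hr' (const_le_pow hL (by norm_num)) (by norm_num) (by norm_num)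
  have k3 : 8 * L ^ 12 * ε ≤ 1 := killD2 (m := 1) hL1 hδ1 hε0 hε' (const_le_pow hL (by norm_num)) (by norm_num)
  have k4 : 8 * L ^ 10 / (δ ^ 3 * r ^ 2) ≤ 1 := killB2 (m := 1) hL1 hδ hδ1 hr' (const_le_pow hL (by norm_num)) (by norm_num) (by norm_num)
  have k5 : 8 * L ^ 13 * ε ≤ 1 := killD2 (m := 1) hL1 hδ1 hε0 hε' (const_le_pow hL (by norm_num)) (by norm_num)
  have k6 : 8 * L ^ 11 / (δ ^ 3 * r ^ 3) ≤ 1 := killB2 (m := 1) hL1 hδ hδ1 hr' (const_le_pow hL (by norm_num)) (by norm_num) (by norm_num)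
  have ir : L ^ 13 * ε / r ≤ L ^ 13 * ε := div_le_self (by positivity) hr1
  have e1 : L ^ 2 * ε + L ^ 2 / (δ ^ 3 * r ^ 4) = (8 * L ^ 2 * ε) / 8 + (8 * L ^ 2 / (δ ^ 3 * r ^ 4)) / 8 := by ring
  have e2 : L ^ 12 * ε + L ^ 10 / (δ ^ 3 * r ^ 2) = (8 * L ^ 12 * ε) / 8 + (8 * L ^ 10 / (δ ^ 3 * r ^ 2)) / 8 := by ring
  have e3 : L ^ 13 * ε + L ^ 11 / (δ ^ 3 * r ^ 3) = (8 * L ^ 13 * ε) / 8 + (8 * L ^ 11 / (δ ^ 3 * r ^ 3)) / 8 := by ring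
  have hb : bT ≤ 1 / 4 := by linarith
  have hMa : ξn + Va + bT * (11 / 10) + s ≤ 1 := by linarith
  have hb2 : bT ≤ 1 / 2 := by linarith
  -- ρ₀ ≥ 64
  have hρ64 : 64 ≤ ρ₀ := by
    refine le_trans ?_ hρ₀lo
    rw [le_div_iff₀ (by positivity)]
    calc 64 * (16 * L ^ 90) = 1024 * L ^ 90 := by ring
      _ ≤ L * L ^ 90 := mul_le_mul_of_nonneg_right (by linarith) (by positivity)
      _ = L ^ 91 := by ring
      _ ≤ L ^ 1000 := pw (by norm_num)
      _ ≤ r := hr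
  have hθ : 2 * ((1 / (64 * L ^ 90)) * r) ≤ ρ₀ / 2 := by
    have e : 2 * ((1 / (64 * L ^ 90)) * r) = (r / (16 * L ^ 90)) / 2 := by field_simp; ring
    rw [e]; linarith
  refine ⟨hslope, hMa, hb2, ?_, ?_, hρ64, ?_, ?_, ?_⟩
  · nlinarith
  · have hρr : ρ₀ ≤ r := hρ₀hi.trans (div_le_self hr0.le (one_le_pow₀ hL1))
    nlinarith
  · have hL70 : (1475200 : ℝ) ≤ L ^ 70 := le_trans (by linarith) (le_self_pow₀ hL1 (by norm_num))
    have h70 : r / L ^ 70 ≤ r / 1475200 := div_le_div_of_nonneg_left hr0.le (by norm_num) hL70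
    have : (307200 : ℝ) ≤ r := le_trans (by linarith) ((le_self_pow₀ hL1 (by norm_num)).trans hr)
    have h1 : 737600 * ρ₀ ≤ r / 2 := by
      have := hρ₀hi.trans h70
      rw [le_div_iff₀ (by norm_num)] at this
      linarith
    linarith
  · have hL70 : (4 : ℝ) ≤ L ^ 70 := le_trans (by linarith) (le_self_pow₀ hL1 (by norm_num))
    exact hρ₀hi.trans (div_le_div_of_nonneg_left hr0.le (by norm_num) hL70)
  · have hL70 : (8 : ℝ) ≤ L ^ 70 := le_trans (by linarith) (le_self_pow₀ hL1 (by norm_num))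
    exact hρ₀hi.trans (div_le_div_of_nonneg_left hr0.le (by norm_num) hL70)

end Summit.AtomisticToContinuum.Crystallization.Theorems.ExcessDecayLiouville
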